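import Summits.RiemannHypothesis.RiemannHypothesis.Theses.GapsEvoDoors
import Literature.NumberTheory.LFunctions.ZetaSpacingDensityDistinctGaps

/-!
# GapsEvoDoors — `SpacingToCI` (item stmt-RiemannHypothesis-22423): spacings WITH multiplicity feed Conrey–Iwaniec

Route `GapsEvoDoors`, support `SpacingToCI` (the CI exit of the door-(a) chain; PREREG-GAPS-4 E5):
on RH, a positive density of SPACINGS `γ_{n+1} − γ_n ≤ 2πλ/log T` counted WITH multiplicity
(`BGMM2023.SpacingDensityPos λ`, `0 ≤ λ < ½`), plus one close pair below height `2001`, gives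
`∃ c > 0, SubnormalGapsHypothesis c` (Conrey–Iwaniec 2002, (1.22)). The tree has this bridge for
DISTINCT gaps (`BGMM2023.le_ncard_closeCriticalZeros_of_gapDensityPos`,
`subnormalGapsHypothesis_of_gapDensityPos`, `ZetaSpacingDensityRH.lean`), where `n ↦ γ_n` is
injective on the counted indices. With multiplicity two things change, and this file supplies both:

* a REPEATED ordinate `γ_n = γ_{n+1}` is, on RH, a MULTIPLE zero `½ + iγ_n` of `ζ`
  (`deriv_riemannZeta_eq_zero_of_zetaOrdinate_eq`: the ordinate fibre `#{k < N(T) : γ_k = v}` of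
  the enumeration is `Σ_{ρ : Im ρ = v} m(ρ)` — tree `Montgomery.card_filter_zetaOrdinate_eq` — and on
  RH that fibre of the zero box is the single point `½ + iv`, so two indices force `m ≥ 2`, i.e.
  `ζ′(½ + iv) = 0` by `riemannZetaZeroOrder_eq_one_iff_deriv_ne_zero`); Conrey–Iwaniec's set COUNTS
  such zeros (first disjunct of the tree's `HasCloseCriticalNeighbour`), so every counted index
  `n` with `γ_n ≥ H₀ = exp((1 − 2λ)⁻²)` lands in `closeCriticalZeros T`
  (`zetaOrdinate_mem_closeCriticalZeros`);
* the map `n ↦ γ_n` is no longer injective, but its fibres are bounded by the window counts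
  `W(n) = N(γ_n + 2π/log T) − N(γ_n − 2π/log T)` (tree `card_eq_add_card_up_le_windowCount`), and
  `Σ_{n < N(T)} W(n)² ≪ N(T)` on RH (Bui–Goldston–Milinovich–Montgomery 2023, Proposition 2; tree
  `BGMM2023.sum_windowCount_pow_le_count_of_RH`): discarding the indices with `W(n) > K`
  (at most `C N(T)/K² ≤ A N(T)/4` of them, Markov) leaves `≥ ¾ A N(T)` counted indices whose
  fibres have size `≤ K`, hence `≥ (¾ A N(T) − N(H₀))/K ≫ T log T` DISTINCT members of
  Conrey–Iwaniec's set (`le_ncard_closeCriticalZeros_of_spacingDensityPos`), and the tree's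
  `subnormalGapsHypothesis_of_eventually` finishes with the height-`2001` input.

All inputs are tree theorems; RH is the antecedent. RH-sentence (c): a record INSIDE route
GapsEvoDoors (the CI exit of crux `FragmentToCI`; conditional `Δ_CI` bookkeeping) — toward
RiemannHypothesis: 0. Nothing here bears on the truth of RH.
-/

noncomputable section

open Set Real Finset Literature.NumberTheory.LFunctions
open Literature.NumberTheory.LFunctions.BGMM2023

set_option linter.dupNamespace false  -- the mandated namespace repeats `RiemannHypothesis`

namespace Summit.RiemannHypothesis.RiemannHypothesis.Theorems.GapsEvoDoorsSpacingToCI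

/-! ### 1. A repeated ordinate is a multiple zero (on RH) -/

/-- **On RH, `γ_n = γ_m` with `n ≠ m` forces `ζ′(½ + iγ_n) = 0`.** The indices `k < N(γ_n)` with
`γ_k = γ_n` number `Σ_{ρ ∈ box, Im ρ = γ_n} m(ρ)` (ordinate dictionary), on RH the only such `ρ` is
`½ + iγ_n`, and `n, m` are two such indices; so `m(½ + iγ_n) ≥ 2`, which for a non-trivial zero is
`ζ′ = 0`. -/
theorem deriv_riemannZeta_eq_zero_of_zetaOrdinate_eq (hRH : _root_.RiemannHypothesis) {n m : ℕ}
    (hnm : n ≠ m) (h : zetaOrdinate n = zetaOrdinate m) :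
    deriv riemannZeta (1 / 2 + zetaOrdinate n * Complex.I) = 0 := by
  classical
  set v : ℝ := zetaOrdinate n with hv
  have hvpos : 0 < v := zetaOrdinate_pos_holds n
  have hζ : riemannZeta (1 / 2 + v * Complex.I) = 0 := riemannZeta_half_add_zetaOrdinate hRH n
  have hbox : (1 / 2 + v * Complex.I : ℂ) ∈ zetaZeroBox 0 v := by
    refine ⟨hζ, ?_, ?_, ?_, ?_⟩
    · norm_num
    · norm_num
    · simpa using hvpos
    · simp
  have hfib : {ρ : ℂ | ρ ∈ zetaZeroBox 0 v ∧ ρ.im = v} = {(1 / 2 + v * Complex.I : ℂ)} := by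
    ext ρ
    simp only [Set.mem_setOf_eq, Set.mem_singleton_iff]
    constructor
    · rintro ⟨hρ, him⟩
      apply Complex.ext
      · rw [re_eq_one_half_of_mem_zetaZeroBox hRH hρ]; norm_num
      · rw [him]; simp
    · rintro rfl
      exact ⟨hbox, by simp⟩
  have hcard := Montgomery.card_filter_zetaOrdinate_eq v v
  rw [hfib, finsum_mem_singleton] at hcard
  have hn : n ∈ (Finset.range (zetaZeroCount v)).filter (fun k ↦ zetaOrdinate k = v) := by
    rw [Finset.mem_filter, Finset.mem_range]
    exact ⟨Montgomery.zetaOrdinate_le_iff_lt.1 le_rfl, rfl⟩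
  have hm : m ∈ (Finset.range (zetaZeroCount v)).filter (fun k ↦ zetaOrdinate k = v) := by
    rw [Finset.mem_filter, Finset.mem_range]
    exact ⟨Montgomery.zetaOrdinate_le_iff_lt.1 (le_of_eq h.symm), h.symm⟩
  have h2 : 1 < ((Finset.range (zetaZeroCount v)).filter (fun k ↦ zetaOrdinate k = v)).card :=
    Finset.one_lt_card.2 ⟨n, hn, m, hm, hnm⟩
  have hord : riemannZetaZeroOrder (1 / 2 + v * Complex.I) ≠ 1 := by
    have : (1 : ℤ) < riemannZetaZeroOrder (1 / 2 + v * Complex.I) := by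
      rw [← hcard]; exact_mod_cast h2
    exact ne_of_gt this
  have hnt : (1 / 2 + v * Complex.I : ℂ) ∈ ZetaZeros.riemannZetaNontrivialZeros :=
    zetaZeroBox_subset_riemannZetaNontrivialZeros 0 v hbox
  by_contra hd
  exact hord ((riemannZetaZeroOrder_eq_one_iff_deriv_ne_zero hnt).2 hd)

/-- **Every counted spacing above `H₀` is a point of Conrey–Iwaniec's set.** On RH, `0 ≤ λ < ½`,
`n < N(T)`, `γ_{n+1} − γ_n ≤ 2πλ/log T` and `γ_n ≥ exp((1 − 2λ)⁻²)`: if `γ_n < γ_{n+1}` the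
neighbour `γ_{n+1}` is within `2πλ/log T ≤ (π/log γ_n)(1 − 1/√log γ_n)` (tree
`two_pi_mul_div_log_le_ciRadius`); if `γ_n = γ_{n+1}` the zero is multiple. -/
theorem zetaOrdinate_mem_closeCriticalZeros (hRH : _root_.RiemannHypothesis) {lam T : ℝ}
    (hlam0 : 0 ≤ lam) (hlam : lam < 1 / 2) {n : ℕ} (hn : n < zetaZeroCount T)
    (hgap : zetaOrdinate (n + 1) - zetaOrdinate n ≤ 2 * π * lam / Real.log T)
    (hH : Real.exp ((1 - 2 * lam)⁻¹ ^ 2) ≤ zetaOrdinate n) :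
    zetaOrdinate n ∈ closeCriticalZeros T := by
  have hγT : zetaOrdinate n ≤ T := Montgomery.zetaOrdinate_le_iff_lt.2 hn
  have hγpos : 0 < zetaOrdinate n := zetaOrdinate_pos_holds n
  refine ⟨hγpos, hγT, riemannZeta_half_add_zetaOrdinate hRH n, ?_⟩
  rcases (zetaOrdinate_mono_holds (Nat.le_succ n)).lt_or_eq with hlt | heq
  · have hγ1 : 1 < zetaOrdinate n := by
      have h12 : 0 < 1 - 2 * lam := by linarith
      have hx : 0 < (1 - 2 * lam)⁻¹ ^ 2 := pow_pos (inv_pos.mpr h12) 2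
      have : 1 < Real.exp ((1 - 2 * lam)⁻¹ ^ 2) := by linarith [Real.add_one_lt_exp hx.ne']
      linarith
    have hlogγ : (1 - 2 * lam)⁻¹ ^ 2 ≤ Real.log (zetaOrdinate n) := by
      rw [← Real.log_exp ((1 - 2 * lam)⁻¹ ^ 2)]
      exact Real.log_le_log (Real.exp_pos _) hH
    refine Or.inr ⟨zetaOrdinate (n + 1), ne_of_gt hlt,
      riemannZeta_half_add_zetaOrdinate hRH (n + 1), ?_⟩
    rw [abs_sub_comm, abs_of_pos (sub_pos.mpr hlt)]
    exact hgap.trans (two_pi_mul_div_log_le_ciRadius hlam0 hlam hγ1 hγT hlogγ)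
  · exact Or.inl (deriv_riemannZeta_eq_zero_of_zetaOrdinate_eq hRH (Nat.succ_ne_self n).symm heq)

/-! ### 2. The count: `#closeCriticalZeros T ≫ T log T` from a positive density of spacings -/

set_option maxHeartbeats 400000 in
/-- **On RH, `lim inf_T D(λ,T) > 0` with `λ < ½` gives `≫ T log T` points of Conrey–Iwaniec's set.**
Counted indices with window count `W(n) = N(γ_n + 2π/log T) − N(γ_n − 2π/log T) > K` are at most
`C N(T)/K²` (`Σ W² ≤ C N(T)`, BGMM 2023 Prop. 2), the others map `≤ K`-to-one onto ordinates
(`#{k < N(T) : γ_k = γ_n} ≤ W(n)`), those above `H₀ = exp((1 − 2λ)⁻²)` into `closeCriticalZeros T`;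
with `K ≥ 4C/A`, `N(H₀) ≤ A N(T)/4` and `N(T) ≥ T log T/4π` this gives
`#closeCriticalZeros T ≥ A T log T/(8πK)`. -/
theorem le_ncard_closeCriticalZeros_of_spacingDensityPos (hRH : _root_.RiemannHypothesis)
    {lam : ℝ} (hlam0 : 0 ≤ lam) (hlam : lam < 1 / 2) (hd : SpacingDensityPos lam) :
    ∃ c : ℝ, 0 < c ∧ ∃ T₁ : ℝ, ∀ T : ℝ, T₁ ≤ T →
      c * T * Real.log T ≤ ((closeCriticalZeros T).ncard : ℝ) := by
  classical
  obtain ⟨A, hA, T₀, hT₀⟩ := hd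
  obtain ⟨C, T₂, hC, hW⟩ := sum_windowCount_pow_le_count_of_RH hRH one_pos 2
  obtain ⟨T₃, hT₃⟩ := SelbergFujii.exists_mul_log_le_zetaZeroCount
  set H₀ : ℝ := Real.exp ((1 - 2 * lam)⁻¹ ^ 2) with hH₀
  set N₀ : ℝ := (zetaZeroCount H₀ : ℝ) with hN₀
  have hN₀0 : 0 ≤ N₀ := by positivity
  have hπ := Real.pi_pos
  -- the fibre cap `K ≥ max(1, 4C/A)`
  set K : ℕ := ⌈4 * C / A⌉₊ + 1 with hK
  have hKge : 4 * C / A ≤ (K : ℝ) := by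
    have := Nat.le_ceil (4 * C / A)
    rw [hK]; push_cast; linarith
  have hK1 : (1 : ℝ) ≤ K := by rw [hK]; push_cast; linarith [Nat.cast_nonneg (α := ℝ) ⌈4 * C / A⌉₊]
  have hKpos : (0 : ℝ) < K := by linarith
  refine ⟨A / (8 * π * K), by positivity,
    max (max T₀ T₂) (max (max T₃ (Real.exp 1)) (16 * π * N₀ / A)), fun T hT ↦ ?_⟩
  simp only [max_le_iff] at hT
  obtain ⟨⟨hT0, hT2⟩, ⟨hT3, hTe⟩, hTN⟩ := hT
  have hTpos : 0 < T := lt_of_lt_of_le (Real.exp_pos 1) hTe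
  have hlogT : 1 ≤ Real.log T := by
    rw [← Real.log_exp 1]; exact Real.log_le_log (Real.exp_pos 1) hTe
  set M : ℕ := zetaZeroCount T with hM
  have hM0 : (0 : ℝ) ≤ M := Nat.cast_nonneg _
  set δ : ℝ := 2 * π * 1 / Real.log T with hδ
  have hδpos : 0 < δ := by positivity
  set W : ℕ → ℝ := fun n ↦
    (zetaZeroCount (zetaOrdinate n + δ) : ℝ) - zetaZeroCount (zetaOrdinate n - δ) with hWdef
  -- the counted spacings `S`, split by the size of the window count
  set S : Finset ℕ := (Finset.range M).filter fun n ↦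
      zetaOrdinate (n + 1) - zetaOrdinate n ≤ 2 * π * lam / Real.log T with hS
  have hScard : A * M ≤ (S.card : ℝ) := hT₀ T hT0
  have hWsum : ∑ n ∈ Finset.range M, W n ^ 2 ≤ C * M := hW T hT2
  set S₂ : Finset ℕ := S.filter fun n ↦ (K : ℝ) < W n with hS₂
  set S₁ : Finset ℕ := S.filter fun n ↦ ¬ (K : ℝ) < W n with hS₁
  have hsplit : (S.card : ℝ) = S₂.card + S₁.card := by
    rw [hS₂, hS₁]; exact_mod_cast (Finset.card_filter_add_card_filter_not _).symm
  -- Markov: `K² #S₂ ≤ Σ W² ≤ C M`, and `K² ≥ K ≥ 4C/A`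
  have hS₂le : (S₂.card : ℝ) ≤ A * M / 4 := by
    have h1 : (K : ℝ) ^ 2 * S₂.card ≤ ∑ n ∈ S₂, W n ^ 2 := by
      have : ∑ n ∈ S₂, (K : ℝ) ^ 2 ≤ ∑ n ∈ S₂, W n ^ 2 := by
        refine Finset.sum_le_sum fun n hn ↦ ?_
        rw [hS₂, Finset.mem_filter] at hn
        have hKn : (K : ℝ) < W n := hn.2
        nlinarith
      rw [Finset.sum_const, nsmul_eq_mul] at this
      linarith
    have h2 : ∑ n ∈ S₂, W n ^ 2 ≤ ∑ n ∈ Finset.range M, W n ^ 2 := by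
      refine Finset.sum_le_sum_of_subset_of_nonneg ?_ fun n _ _ ↦ sq_nonneg _
      intro n hn
      rw [hS₂, Finset.mem_filter, hS, Finset.mem_filter] at hn
      exact hn.1.1
    have h3 : (K : ℝ) ^ 2 * S₂.card ≤ C * M := h1.trans (h2.trans hWsum)
    have h4 : 4 * C ≤ A * (K : ℝ) ^ 2 := by
      have := (div_le_iff₀ hA).mp hKge
      nlinarith
    have h5 : (K : ℝ) ^ 2 * (4 * S₂.card) ≤ (K : ℝ) ^ 2 * (A * M) := by nlinarith
    have h6 := le_of_mul_le_mul_left h5 (by positivity : (0 : ℝ) < (K : ℝ) ^ 2)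
    linarith
  -- the counted indices with small window and high ordinate
  set S₁' : Finset ℕ := S₁.filter fun n ↦ H₀ ≤ zetaOrdinate n with hS₁'
  have hlow : (S₁.card : ℝ) ≤ S₁'.card + N₀ := by
    have hsplit' : S₁.card = S₁'.card + (S₁.filter fun n ↦ ¬ H₀ ≤ zetaOrdinate n).card := by
      rw [hS₁']; exact (Finset.card_filter_add_card_filter_not _).symm
    have hL : (S₁.filter fun n ↦ ¬ H₀ ≤ zetaOrdinate n).card ≤ zetaZeroCount H₀ := by
      calc (S₁.filter fun n ↦ ¬ H₀ ≤ zetaOrdinate n).card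
          ≤ (Finset.range (zetaZeroCount H₀)).card := by
            refine Finset.card_le_card fun n hn ↦ ?_
            rw [Finset.mem_filter] at hn
            exact Finset.mem_range.2
              (Montgomery.zetaOrdinate_le_iff_lt.1 (le_of_lt (not_le.mp hn.2)))
        _ = zetaZeroCount H₀ := Finset.card_range _
    have hL' : ((S₁.filter fun n ↦ ¬ H₀ ≤ zetaOrdinate n).card : ℝ) ≤ N₀ := by
      rw [hN₀]; exact_mod_cast hL
    rw [hsplit', Nat.cast_add]
    linarith
  -- its image lies in Conrey–Iwaniec's set
  have himage : ((S₁'.image zetaOrdinate : Finset ℝ) : Set ℝ) ⊆ closeCriticalZeros T := by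
    intro γ hγ
    rw [Finset.coe_image] at hγ
    obtain ⟨n, hn, rfl⟩ := hγ
    rw [Finset.mem_coe, hS₁', Finset.mem_filter, hS₁, Finset.mem_filter, hS, Finset.mem_filter,
      Finset.mem_range] at hn
    obtain ⟨⟨⟨hnM, hgap⟩, -⟩, hH⟩ := hn
    exact zetaOrdinate_mem_closeCriticalZeros hRH hlam0 hlam hnM hgap hH
  -- and its fibres have size `≤ K`
  have hfib : ∀ v ∈ S₁'.image zetaOrdinate,
      (S₁'.filter fun n ↦ zetaOrdinate n = v).card ≤ K := by
    intro v hv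
    rw [Finset.mem_image] at hv
    obtain ⟨g, hg, rfl⟩ := hv
    have hgS₁ : g ∈ S₁ := (Finset.mem_filter.1 hg).1
    have hWg : W g ≤ K := not_lt.1 (Finset.mem_filter.1 hgS₁).2
    have h1 : (S₁'.filter fun n ↦ zetaOrdinate n = zetaOrdinate g).card ≤
        ((Finset.range M).filter fun n ↦ zetaOrdinate n = zetaOrdinate g).card := by
      refine Finset.card_le_card fun n hn ↦ ?_
      rw [Finset.mem_filter] at hn ⊢
      refine ⟨?_, hn.2⟩
      have h' := hn.1
      rw [hS₁', Finset.mem_filter, hS₁, Finset.mem_filter, hS, Finset.mem_filter] at h'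
      exact h'.1.1.1
    have h2 : (((Finset.range M).filter fun n ↦ zetaOrdinate n = zetaOrdinate g).card : ℝ) ≤ W g := by
      have h' := card_eq_add_card_up_le_windowCount hδpos M g
      push_cast at h'
      have h0 : (0 : ℝ) ≤ (((Finset.range M).filter fun m ↦ zetaOrdinate g < zetaOrdinate m ∧
          zetaOrdinate m - zetaOrdinate g ≤ δ).card : ℝ) := Nat.cast_nonneg _
      linarith
    have h3 : (((S₁'.filter fun n ↦ zetaOrdinate n = zetaOrdinate g).card : ℕ) : ℝ) ≤ K :=
      calc (((S₁'.filter fun n ↦ zetaOrdinate n = zetaOrdinate g).card : ℕ) : ℝ)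
          ≤ (((Finset.range M).filter fun n ↦ zetaOrdinate n = zetaOrdinate g).card : ℝ) := by
            exact_mod_cast h1
        _ ≤ W g := h2
        _ ≤ K := hWg
    exact_mod_cast h3
  have hmul : S₁'.card ≤ K * (S₁'.image zetaOrdinate).card :=
    Finset.card_le_mul_card_image _ _ hfib
  have hmulR : (S₁'.card : ℝ) ≤ K * ((S₁'.image zetaOrdinate).card : ℝ) := by exact_mod_cast hmul
  have hncard : ((S₁'.image zetaOrdinate).card : ℝ) ≤ (closeCriticalZeros T).ncard := by
    have := Set.ncard_le_ncard himage (closeCriticalZeros_finite T)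
    rw [Set.ncard_coe_finset] at this
    exact_mod_cast this
  -- assembly: `N(T) ≥ T log T/4π`, `N₀ ≤ A N(T)/4`
  have hN : T * Real.log T / (4 * π) ≤ M := hT₃ T hT3
  have hX1 : T / (4 * π) ≤ T * Real.log T / (4 * π) := by
    apply div_le_div_of_nonneg_right _ (by positivity)
    nlinarith
  have hN₀le : N₀ ≤ A * M / 4 := by
    have h1 : N₀ * (16 * π) ≤ A * T := by
      have := (div_le_iff₀ hA).mp hTN
      linarith
    have h2 : N₀ ≤ A / 4 * (T / (4 * π)) := by
      rw [show A / 4 * (T / (4 * π)) = A * T / (16 * π) by field_simp; ring,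
        le_div_iff₀ (by positivity)]
      exact h1
    have h3 : A / 4 * (T / (4 * π)) ≤ A / 4 * M :=
      mul_le_mul_of_nonneg_left (hX1.trans hN) (by positivity)
    linarith
  have e1 : A * (T * Real.log T / (4 * π)) / 2 ≤ A * M / 2 := by
    have := mul_le_mul_of_nonneg_left hN hA.le
    linarith
  have e2 : A * M / 2 ≤ S₁'.card := by linarith
  have e3 : (K : ℝ) * ((S₁'.image zetaOrdinate).card : ℝ) ≤ K * (closeCriticalZeros T).ncard :=
    mul_le_mul_of_nonneg_left hncard hKpos.le
  have key : A / (8 * π * K) * T * Real.log T = (A * (T * Real.log T / (4 * π)) / 2) / K := by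
    field_simp
    ring
  rw [key, div_le_iff₀ hKpos]
  linarith

/-! ### 3. The item -/

/-- **`SpacingToCI` holds** (item stmt-RiemannHypothesis-22423 of route GapsEvoDoors): on RH, a
positive density of spacings WITH multiplicity below `λ₀ < ½` mean spacings, plus one close pair of
critical zeros below height `2001`, gives `∃ c > 0, SubnormalGapsHypothesis c` (Conrey–Iwaniec's
(1.22)) — `le_ncard_closeCriticalZeros_of_spacingDensityPos` and the tree's
`BGMM2023.subnormalGapsHypothesis_of_eventually`. A record INSIDE the route (CI exit of crux
`FragmentToCI`); toward RiemannHypothesis: 0. -/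
theorem SpacingToCI_holds :
    Summit.RiemannHypothesis.RiemannHypothesis.Theses.GapsEvoDoors.SpacingToCI := by
  unfold Summit.RiemannHypothesis.RiemannHypothesis.Theses.GapsEvoDoors.SpacingToCI
  intro hRH lam hlam0 hlam hd h₀
  exact subnormalGapsHypothesis_of_eventually
    (le_ncard_closeCriticalZeros_of_spacingDensityPos hRH hlam0 hlam hd) h₀

end Summit.RiemannHypothesis.RiemannHypothesis.Theorems.GapsEvoDoorsSpacingToCI

end
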